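import Summits.ResolutionOfSingularities.ResolutionOfSingularities.Theorems.WildConesCampaignW46ThreefoldsCharTwoSplittingRegime
import Summits.ResolutionOfSingularities.ResolutionOfSingularities.Theorems.WildConesCampaignW46ThreefoldsCharTwoFamily

/-!
# [OURS · L1 W4.6, rung (ii) at p = 2 — HONEST SCOPE MARKER] Already in FOUR variables the order-2-cleaned
# regime is not closed under the point-blow-up dynamics: `z² = u₀u₁ + u₂⁵ + u₃⁵`, over EVERY field of
# characteristic 2

Cell res-hironaka (LADDER-RESOLUTION rung L, D-0089), slot W4.6, seat res-L1-s46-pv-4 (gen 2); host route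
`WildCones`, crux `ClassicalRegimes` (stmt-ResolutionOfSingularities-16884). Companion of `…CharTwoSplittingRegime`
(p479260: for THREEFOLDS an order-2-cleaned isolated double point with a double successor has an ISOLATED successor)
and of `…HypersurfacesCharTwoFivefoldNonClosure` (p484275, the five-variable failure). THIS file lowers the
failure to `n = 4`, the first dimension above the rung: the closure is EXACTLY a threefold phenomenon. Mechanism:
after the hyperbolic pair `u₀u₁` the residual is the SURFACE double point `z² = u₂⁵ + u₃⁵` of cleaned order `5 ≥ 4`,
and surface states of cleaned order `≥ 4` have no isolated successor (the crux's `stub_highOrdNotIsol`); for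
threefolds the residual is a CURVE, where `a' = X² G'` always transfers isolatedness (`curve_finite_strict`).

HONEST FRAMING. Everything here is OURS (route WildCones' own typed dynamics); NOTHING is a statement of
H. Hironaka's manuscript [Hironaka2017]; no FACT-LIST premise. AI review is weaker than expert review.

THE EXAMPLE (any field `κ` of characteristic `2`, `n = 4`). `a = u₀u₁ + u₂⁵ + u₃⁵`: cleaned, a double point,
order-2 cleaned, ISOLATED (`∂a = (u₁, u₀, u₂⁴, u₃⁴) ⊇ 𝔪⁷`; `μ = 16`). Blow up, chart `u₂`, NO translation:
`a∘Φ = u₂²(u₀u₁ + u₂³ + u₂³u₃⁵)` exactly; `G = u₀u₁ + u₂³ + u₂³u₃⁵` is unchanged by cleaning, a double point,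
order-2 cleaned, but `∂G = (u₁, u₀, u₂²(1 + u₃⁵), u₂³u₃⁴) ⊆ (u₀, u₁, u₂)`: three non-units in four variables, so
the Milnor algebra is infinite (Krull, `not_finite_quot_of_le_span`).

Main decl: `fourfold_splittingRegime_not_closed` — `∃ c i τ` (`n = 4`) with `Isol c ∧ MultP c ∧ OrdP c ∧ MultP c' ∧
OrdP c' ∧ ¬ Isol c'`; the other decls compute the example.
-/

noncomputable section

-- single-problem summit: the doubled namespace component `ResolutionOfSingularities` is forced
set_option linter.dupNamespace false

open scoped BigOperators Classical

open MvPowerSeries IsLocalRing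

open Literature.AlgebraicGeometry.Resolution

namespace Summit.ResolutionOfSingularities.ResolutionOfSingularities.Theorems

namespace CampaignW46.ThreefoldsCharTwo

open WildCones WildCones.MuDropCharTwoOrdP

variable {κ : Type} [Field κ]

/-! ## The start state `u₀u₁ + u₂⁵ + u₃⁵` -/

/-- Coefficients of `X₀X₁ + X₂⁵ + X₃⁵`. [folklore] -/
theorem coeff_fourStart (A : Fin 4 →₀ ℕ) :
    coeff A ((X 0 * X 1 + X 2 ^ 5 + X 3 ^ 5 : MvPowerSeries (Fin 4) κ)) =
      (if A = Finsupp.single 0 1 + Finsupp.single 1 1 then 1 else 0) + (if A = Finsupp.single 2 5 then 1 else 0) +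
        (if A = Finsupp.single 3 5 then 1 else 0) := by
  rw [map_add, map_add, X_pow_eq, X_pow_eq, X_def, X_def, monomial_mul_monomial, one_mul, coeff_monomial,
    coeff_monomial, coeff_monomial]

/-- The start series has no monomial with all exponents even. [folklore] -/
theorem fourStart_coeff_eq_zero_of_even (A : Fin 4 →₀ ℕ) (hA : ∀ j, 2 ∣ A j) :
    coeff A ((X 0 * X 1 + X 2 ^ 5 + X 3 ^ 5 : MvPowerSeries (Fin 4) κ)) = 0 := by
  rw [coeff_fourStart]
  have h0 : A ≠ Finsupp.single 0 1 + Finsupp.single 1 1 := by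
    rintro rfl
    have := hA 0
    simp at this
  have h : ∀ s : Fin 4, A ≠ Finsupp.single s 5 := by
    rintro s rfl
    have := hA s
    rw [Finsupp.single_eq_same] at this
    omega
  rw [if_neg h0, if_neg (h 2), if_neg (h 3)]
  simp

/-- The pair exponent `e₀ + e₁` is not `5eₛ`. [folklore] -/
theorem four_pair_ne_pow (s : Fin 4) :
    (Finsupp.single 0 1 + Finsupp.single 1 1 : Fin 4 →₀ ℕ) ≠ Finsupp.single s 5 := by
  intro h
  have := congrArg Finsupp.degree h
  simp only [map_add, Finsupp.degree_single] at this
  omega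

/-- The pair coefficient `[X₀X₁]` of the start series is `1`. [folklore] -/
theorem coeff_pair_fourStart :
    coeff (Finsupp.single 0 1 + Finsupp.single 1 1) ((X 0 * X 1 + X 2 ^ 5 + X 3 ^ 5 : MvPowerSeries (Fin 4) κ)) = 1 := by
  rw [coeff_fourStart, if_pos rfl, if_neg (four_pair_ne_pow 2), if_neg (four_pair_ne_pow 3)]
  simp

/-- [OURS · L1 W4.6] A state (`n = 4`) with cleaned series `u₀u₁ + u₂⁵ + u₃⁵` is a double point. [folklore] -/
theorem multP_of_ser_eq_fourStart {c : (Fin 4 → ℕ) → κ}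
    (hc : ser 2 4 κ c = X 0 * X 1 + X 2 ^ 5 + X 3 ^ 5) : MultP 2 4 κ c := by
  rw [multP_iff_ser, hc]
  constructor
  · intro h
    have h1 := congrArg (coeff (Finsupp.single (0 : Fin 4) 1 + Finsupp.single 1 1)) h
    rw [coeff_pair_fourStart, map_zero] at h1
    exact one_ne_zero h1
  · refine nat_le_order fun d hd => ?_
    rw [coeff_fourStart]
    have h0 : d ≠ Finsupp.single 0 1 + Finsupp.single 1 1 := by
      rintro rfl
      simp only [map_add, Finsupp.degree_single] at hd
      omega
    have h : ∀ s : Fin 4, d ≠ Finsupp.single s 5 := by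
      rintro s rfl
      rw [Finsupp.degree_single] at hd
      omega
    rw [if_neg h0, if_neg (h 2), if_neg (h 3)]
    simp

/-- [OURS · L1 W4.6] … and order-2 cleaned (`u₀u₁`). [folklore] -/
theorem ordP_of_ser_eq_fourStart {c : (Fin 4 → ℕ) → κ}
    (hc : ser 2 4 κ c = X 0 * X 1 + X 2 ^ 5 + X 3 ^ 5) : OrdP 2 4 κ c := by
  rw [ordP_two_iff_exists_pair, hc]
  exact ⟨0, 1, by decide, by rw [coeff_pair_fourStart]; exact one_ne_zero⟩

/-- In characteristic two: `∂₀ a = X₁`, `∂₁ a = X₀`, `∂ₛ a = Xₛ⁴` (`s = 2, 3`) for the start series (`5 = 1`).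
[folklore] -/
theorem pderiv_fourStart [CharP κ 2] (s : Fin 4) :
    MvPowerSeries.pderiv s ((X 0 * X 1 + X 2 ^ 5 + X 3 ^ 5 : MvPowerSeries (Fin 4) κ)) =
      if s = 0 then X 1 else if s = 1 then X 0 else X s ^ 4 := by
  have h5 : (5 : MvPowerSeries (Fin 4) κ) = 1 := by
    rw [show (5 : MvPowerSeries (Fin 4) κ) = 2 * 2 + 1 by norm_num, ← map_ofNat (C : κ →+* _) 2,
      CharTwo.two_eq_zero, map_zero, mul_zero, zero_add]
  rw [map_add, map_add, Derivation.leibniz, Derivation.leibniz_pow, Derivation.leibniz_pow,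
    MvPowerSeries.pderiv_X, MvPowerSeries.pderiv_X, MvPowerSeries.pderiv_X, MvPowerSeries.pderiv_X]
  fin_cases s <;> simp [smul_eq_mul, h5]

/-- `𝔪⁷ ≤ (∂a)` for the start series: a monomial of degree `7` in four variables is divisible by `X₀`, by `X₁`,
or by the fourth power of `X₂` or `X₃`. [folklore] -/
theorem maximalIdeal_pow_seven_le_jac_fourStart [CharP κ 2] :
    maximalIdeal (MvPowerSeries (Fin 4) κ) ^ 7 ≤
      Ideal.span (Set.range fun s : Fin 4 =>
        MvPowerSeries.pderiv s ((X 0 * X 1 + X 2 ^ 5 + X 3 ^ 5 : MvPowerSeries (Fin 4) κ))) := by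
  rw [Literature.RingTheory.MvPowerSeries.Jets.maximalIdeal_pow_eq_span_monomial, Ideal.span_le]
  rintro _ ⟨e, he, rfl⟩
  change e.degree = 7 at he
  change (monomial e (1 : κ) : MvPowerSeries (Fin 4) κ) ∈ _
  have mem_of : ∀ (s : Fin 4) (k : ℕ), k ≤ e s →
      (∃ s', (X s : MvPowerSeries (Fin 4) κ) ^ k = MvPowerSeries.pderiv s'
        ((X 0 * X 1 + X 2 ^ 5 + X 3 ^ 5 : MvPowerSeries (Fin 4) κ))) →
      (monomial e (1 : κ) : MvPowerSeries (Fin 4) κ) ∈ Ideal.span (Set.range fun s : Fin 4 =>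
        MvPowerSeries.pderiv s ((X 0 * X 1 + X 2 ^ 5 + X 3 ^ 5 : MvPowerSeries (Fin 4) κ))) := by
    rintro s k hk ⟨s', h⟩
    have hdec : (monomial e (1 : κ) : MvPowerSeries (Fin 4) κ) =
        monomial (e - Finsupp.single s k) (1 : κ) * X s ^ k := by
      rw [X_pow_eq, monomial_mul_monomial, one_mul, tsub_add_cancel_of_le]
      intro t
      by_cases hts : t = s
      · subst hts; rwa [Finsupp.single_eq_same]
      · rw [Finsupp.single_apply, if_neg (Ne.symm hts)]; exact Nat.zero_le _
    rw [hdec]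
    exact Ideal.mul_mem_left _ _ (Ideal.subset_span ⟨s', h.symm⟩)
  by_cases h0 : 1 ≤ e 0
  · exact mem_of 0 1 h0 ⟨1, by rw [pderiv_fourStart]; simp⟩
  by_cases h1 : 1 ≤ e 1
  · exact mem_of 1 1 h1 ⟨0, by rw [pderiv_fourStart]; simp⟩
  have hsum : e.degree = e 0 + e 1 + e 2 + e 3 := by
    rw [degree_eq_sum_univ, Fin.sum_univ_four]
  by_cases h2 : 4 ≤ e 2
  · exact mem_of 2 4 h2 ⟨2, by rw [pderiv_fourStart]; simp⟩
  have h3 : 4 ≤ e 3 := by omega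
  exact mem_of 3 4 h3 ⟨3, by rw [pderiv_fourStart]; simp⟩

/-- [OURS · L1 W4.6] **The start state is ISOLATED** (`μ = 16`): `(∂a) ⊇ 𝔪⁷`. [folklore] -/
theorem isol_of_ser_eq_fourStart [CharP κ 2] {c : (Fin 4 → ℕ) → κ}
    (hc : ser 2 4 κ c = X 0 * X 1 + X 2 ^ 5 + X 3 ^ 5) : Isol 2 4 κ c := by
  rw [isol_iff_finite_pderiv, hc]
  haveI := Literature.RingTheory.MvPowerSeries.Jets.finite_quotient_maximalIdeal_pow
    (σ := Fin 4) (K := κ) 7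
  exact Module.Finite.of_surjective
    (Ideal.Quotient.factorₐ κ maximalIdeal_pow_seven_le_jac_fourStart).toLinearMap
    (Ideal.Quotient.factor_surjective maximalIdeal_pow_seven_le_jac_fourStart)

/-! ## One step: chart `u₂`, no translation -/

/-- The blow-up substitution `Φ_{2,0}` on the start series: `a∘Φ = X₂² · (X₀X₁ + X₂³ + X₂³X₃⁵)` (exactly, in any
characteristic). [folklore] -/
theorem subst_blowFam_fourStart :
    subst (fun s => if s = (2 : Fin 4) then (X 2 : MvPowerSeries (Fin 4) κ)
        else X 2 * (X s + C ((0 : Fin 4 → κ) s))) ((X 0 * X 1 + X 2 ^ 5 + X 3 ^ 5 : MvPowerSeries (Fin 4) κ)) =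
      X 2 ^ 2 * (X 0 * X 1 + X 2 ^ 3 + X 2 ^ 3 * X 3 ^ 5) := by
  have ha := hasSubst_blowFam (κ := κ) (2 : Fin 4) (0 : Fin 4 → κ)
  rw [subst_add ha, subst_add ha, subst_mul ha, subst_pow ha, subst_pow ha, subst_X ha, subst_X ha, subst_X ha,
    subst_X ha]
  rw [if_neg (show (0 : Fin 4) ≠ 2 by decide), if_neg (show (1 : Fin 4) ≠ 2 by decide), if_pos rfl,
    if_neg (show (3 : Fin 4) ≠ 2 by decide)]
  simp only [Pi.zero_apply, map_zero, add_zero]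
  ring

/-- Coefficients of the successor series `X₀X₁ + X₂³ + X₂³X₃⁵`. [folklore] -/
theorem coeff_fourStep (A : Fin 4 →₀ ℕ) :
    coeff A ((X 0 * X 1 + X 2 ^ 3 + X 2 ^ 3 * X 3 ^ 5 : MvPowerSeries (Fin 4) κ)) =
      (if A = Finsupp.single 0 1 + Finsupp.single 1 1 then 1 else 0) + (if A = Finsupp.single 2 3 then 1 else 0) +
        (if A = Finsupp.single 2 3 + Finsupp.single 3 5 then 1 else 0) := by
  rw [map_add, map_add, X_pow_eq, X_pow_eq, X_def, X_def, monomial_mul_monomial, monomial_mul_monomial, one_mul,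
    coeff_monomial, coeff_monomial, coeff_monomial]

/-- The successor series has no monomial with all exponents even (odd `u₀`- or `u₂`-exponent). [folklore] -/
theorem fourStep_coeff_eq_zero_of_even (A : Fin 4 →₀ ℕ) (hA : ∀ j, 2 ∣ A j) :
    coeff A ((X 0 * X 1 + X 2 ^ 3 + X 2 ^ 3 * X 3 ^ 5 : MvPowerSeries (Fin 4) κ)) = 0 := by
  rw [coeff_fourStep]
  have h0 : A ≠ Finsupp.single 0 1 + Finsupp.single 1 1 := by
    rintro rfl
    have := hA 0
    simp at this
  have h1 : A ≠ Finsupp.single 2 3 := by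
    rintro rfl
    have := hA 2
    rw [Finsupp.single_eq_same] at this
    omega
  have h2 : A ≠ Finsupp.single 2 3 + Finsupp.single 3 5 := by
    rintro rfl
    have := hA 2
    simp at this
  rw [if_neg h0, if_neg h1, if_neg h2]
  simp

/-- The pair coefficient `[X₀X₁]` of the successor series is `1`. [folklore] -/
theorem coeff_pair_fourStep :
    coeff (Finsupp.single 0 1 + Finsupp.single 1 1)
      ((X 0 * X 1 + X 2 ^ 3 + X 2 ^ 3 * X 3 ^ 5 : MvPowerSeries (Fin 4) κ)) = 1 := by
  rw [coeff_fourStep, if_pos rfl]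
  have h1 : (Finsupp.single 0 1 + Finsupp.single 1 1 : Fin 4 →₀ ℕ) ≠ Finsupp.single 2 3 := by
    intro h'; have := DFunLike.congr_fun h' 2; simp at this
  have h2 : (Finsupp.single 0 1 + Finsupp.single 1 1 : Fin 4 →₀ ℕ) ≠ Finsupp.single 2 3 + Finsupp.single 3 5 := by
    intro h'; have := DFunLike.congr_fun h' 2; simp at this
  rw [if_neg h1, if_neg h2]
  simp

/-- [OURS · L1 W4.6] **The step on the start state**: the successor in chart `u₂` without translation has cleaned
series `u₀u₁ + u₂³ + u₂³u₃⁵`. [folklore] -/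
theorem ser_step_of_ser_eq_fourStart [CharP κ 2] {c : (Fin 4 → ℕ) → κ}
    (hc : ser 2 4 κ c = X 0 * X 1 + X 2 ^ 5 + X 3 ^ 5) :
    ser 2 4 κ (step 2 4 κ 2 0 c) = X 0 * X 1 + X 2 ^ 3 + X 2 ^ 3 * X 3 ^ 5 := by
  have hM : MultP 2 4 κ c := multP_of_ser_eq_fourStart hc
  have key := X_pow_mul_serT_eq_subst c 2 0 hM
  rw [hc, subst_blowFam_fourStart] at key
  have hX2 : (X 2 : MvPowerSeries (Fin 4) κ) ≠ 0 := fun h => by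
    have h1 := congrArg (coeff (Finsupp.single (2 : Fin 4) 1)) h
    rw [coeff_index_single_self_X, map_zero] at h1
    exact one_ne_zero h1
  have hT := mul_left_cancel₀ (pow_ne_zero 2 hX2) key
  ext A
  rw [coeff_ser_step c 2 0 hM A]
  have hTA : tr 4 κ 2 0 2 (dv 4 κ 2 2 (bl 4 κ 2 (clean 2 4 κ c))) ⇑A =
      coeff A ((X 0 * X 1 + X 2 ^ 3 + X 2 ^ 3 * X 3 ^ 5 : MvPowerSeries (Fin 4) κ)) := by
    rw [← hT]; rfl
  have clean_apply : ∀ (g : (Fin 4 → ℕ) → κ) (B : Fin 4 → ℕ),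
      clean 2 4 κ g B = @ite κ (∀ j, 2 ∣ B j) (Classical.dec _) 0 (g B) := fun _ _ => rfl
  rw [clean_apply]
  by_cases h : ∀ j, 2 ∣ (⇑A) j
  · rw [if_pos h, fourStep_coeff_eq_zero_of_even A h]
  · rw [if_neg h, hTA]

/-- [OURS · L1 W4.6] The successor is a DOUBLE POINT. [folklore] -/
theorem multP_step_fourStart [CharP κ 2] {c : (Fin 4 → ℕ) → κ}
    (hc : ser 2 4 κ c = X 0 * X 1 + X 2 ^ 5 + X 3 ^ 5) : MultP 2 4 κ (step 2 4 κ 2 0 c) := by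
  rw [multP_iff_ser, ser_step_of_ser_eq_fourStart hc]
  constructor
  · intro h
    have h1 := congrArg (coeff (Finsupp.single (0 : Fin 4) 1 + Finsupp.single 1 1)) h
    rw [coeff_pair_fourStep, map_zero] at h1
    exact one_ne_zero h1
  · refine nat_le_order fun d hd => ?_
    rw [coeff_fourStep]
    have h0 : d ≠ Finsupp.single 0 1 + Finsupp.single 1 1 := by
      rintro rfl
      simp only [map_add, Finsupp.degree_single] at hd
      omega
    have h1 : d ≠ Finsupp.single 2 3 := by
      rintro rfl
      rw [Finsupp.degree_single] at hd
      omega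
    have h2 : d ≠ Finsupp.single 2 3 + Finsupp.single 3 5 := by
      rintro rfl
      simp only [map_add, Finsupp.degree_single] at hd
      omega
    rw [if_neg h0, if_neg h1, if_neg h2]
    simp

/-- [OURS · L1 W4.6] The successor is ORDER-2 CLEANED (`u₀u₁`). [folklore] -/
theorem ordP_step_fourStart [CharP κ 2] {c : (Fin 4 → ℕ) → κ}
    (hc : ser 2 4 κ c = X 0 * X 1 + X 2 ^ 5 + X 3 ^ 5) : OrdP 2 4 κ (step 2 4 κ 2 0 c) := by
  rw [ordP_two_iff_exists_pair, ser_step_of_ser_eq_fourStart hc]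
  exact ⟨0, 1, by decide, by rw [coeff_pair_fourStep]; exact one_ne_zero⟩

/-- The partial derivatives of the successor series (characteristic two: `X₁`, `X₀`, `X₂²(1 + X₃⁵)`, `X₂³X₃⁴`) all
lie in the ideal `(X₀, X₁, X₂)`. [folklore] -/
theorem pderiv_fourStep_mem [CharP κ 2] (s : Fin 4) :
    MvPowerSeries.pderiv s ((X 0 * X 1 + X 2 ^ 3 + X 2 ^ 3 * X 3 ^ 5 : MvPowerSeries (Fin 4) κ)) ∈
      Ideal.span ({X 0, X 1, X 2} : Set (MvPowerSeries (Fin 4) κ)) := by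
  have hX0 : (X 0 : MvPowerSeries (Fin 4) κ) ∈ Ideal.span ({X 0, X 1, X 2} : Set (MvPowerSeries (Fin 4) κ)) :=
    Ideal.subset_span (by simp)
  have hX1 : (X 1 : MvPowerSeries (Fin 4) κ) ∈ Ideal.span ({X 0, X 1, X 2} : Set (MvPowerSeries (Fin 4) κ)) :=
    Ideal.subset_span (by simp)
  have hX2 : (X 2 : MvPowerSeries (Fin 4) κ) ∈ Ideal.span ({X 0, X 1, X 2} : Set (MvPowerSeries (Fin 4) κ)) :=
    Ideal.subset_span (by simp)
  have h2 : (2 : MvPowerSeries (Fin 4) κ) = 0 := by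
    rw [← map_ofNat (C : κ →+* _) 2, CharTwo.two_eq_zero, map_zero]
  have h3 : (3 : MvPowerSeries (Fin 4) κ) = 1 := by
    rw [show (3 : MvPowerSeries (Fin 4) κ) = 2 + 1 by norm_num, h2, zero_add]
  have h5 : (5 : MvPowerSeries (Fin 4) κ) = 1 := by
    rw [show (5 : MvPowerSeries (Fin 4) κ) = 2 * 2 + 1 by norm_num, h2, mul_zero, zero_add]
  rw [map_add, map_add, Derivation.leibniz, Derivation.leibniz, Derivation.leibniz_pow, Derivation.leibniz_pow,
    MvPowerSeries.pderiv_X, MvPowerSeries.pderiv_X, MvPowerSeries.pderiv_X, MvPowerSeries.pderiv_X]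
  fin_cases s
  · simp only [smul_eq_mul]; simp; exact hX1
  · simp only [smul_eq_mul]; simp; exact hX0
  · simp only [smul_eq_mul]; simp [h3]
    convert Ideal.mul_mem_right ((X 2 : MvPowerSeries (Fin 4) κ) + X 2 * X 3 ^ 5) _ hX2 using 1
    ring
  · simp only [smul_eq_mul]; simp [h5]
    convert Ideal.mul_mem_right ((X 2 : MvPowerSeries (Fin 4) κ) ^ 2 * X 3 ^ 4) _ hX2 using 1
    ring

/-- [OURS · L1 W4.6; NOT a statement of the manuscript] **The successor is NOT ISOLATED**: its gradient ideal
lies in `(X₀, X₁, X₂)`, three non-units in four variables (Krull, `not_finite_quot_of_le_span`). [folklore] -/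
theorem not_isol_step_fourStart [CharP κ 2] {c : (Fin 4 → ℕ) → κ}
    (hc : ser 2 4 κ c = X 0 * X 1 + X 2 ^ 5 + X 3 ^ 5) : ¬ Isol 2 4 κ (step 2 4 κ 2 0 c) := by
  rw [isol_iff_finite_pderiv, ser_step_of_ser_eq_fourStart hc]
  refine not_finite_quot_of_le_span ({X 0, X 1, X 2} : Finset (MvPowerSeries (Fin 4) κ)) ?_ ?_ ?_
  · intro x hx
    simp only [Finset.coe_insert, Finset.coe_singleton, Set.mem_insert_iff, Set.mem_singleton_iff] at hx
    rw [SetLike.mem_coe,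
      Literature.RingTheory.MvPowerSeries.Jets.mem_maximalIdeal_iff_constantCoeff_eq_zero]
    rcases hx with rfl | rfl | rfl
    · exact constantCoeff_X _
    · exact constantCoeff_X _
    · exact constantCoeff_X _
  · exact lt_of_le_of_lt Finset.card_le_three (by norm_num)
  · rw [Finset.coe_insert, Finset.coe_insert, Finset.coe_singleton, Ideal.span_le]
    rintro _ ⟨s, rfl⟩
    exact pderiv_fourStep_mem s

/-! ## The witness -/

/-- [OURS · L1 W4.6 rung (ii) at `p = 2`, HONEST SCOPE MARKER; NOT a statement of the manuscript]
**ALREADY IN FOUR VARIABLES THE ORDER-2-CLEANED REGIME IS NOT CLOSED.** Over EVERY field of characteristic `2`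
there is an order-2-cleaned ISOLATED double point `c` of `z² = a(u₀,u₁,u₂,u₃)` (`a = u₀u₁ + u₂⁵ + u₃⁵`, `μ = 16`)
whose point-blow-up successor in chart `u₂` (no translation) is an order-2-cleaned double point that is NOT
isolated. Contrast `threefold_isol_step_of_ordP` (p479260): for threefolds this cannot happen — the closure of
the hyperbolic-splitting regime is EXACTLY a threefold phenomenon. [folklore] -/
theorem fourfold_splittingRegime_not_closed (κ : Type) [Field κ] [CharP κ 2] :
    ∃ (c : (Fin 4 → ℕ) → κ) (i : Fin 4) (τ : Fin 4 → κ),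
      Isol 2 4 κ c ∧ MultP 2 4 κ c ∧ OrdP 2 4 κ c ∧
        MultP 2 4 κ (step 2 4 κ i τ c) ∧ OrdP 2 4 κ (step 2 4 κ i τ c) ∧ ¬ Isol 2 4 κ (step 2 4 κ i τ c) := by
  obtain ⟨c, hc⟩ := exists_ser_eq (κ := κ)
    ((X 0 * X 1 + X 2 ^ 5 + X 3 ^ 5 : MvPowerSeries (Fin 4) κ)) fourStart_coeff_eq_zero_of_even
  exact ⟨c, 2, 0, isol_of_ser_eq_fourStart hc, multP_of_ser_eq_fourStart hc, ordP_of_ser_eq_fourStart hc,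
    multP_step_fourStart hc, ordP_step_fourStart hc, not_isol_step_fourStart hc⟩

end CampaignW46.ThreefoldsCharTwo

end Summit.ResolutionOfSingularities.ResolutionOfSingularities.Theorems

end
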